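import Summits.BirchSwinnertonDyer.BirchSwinnertonDyer.Theorems.EisensteinPrimesBSDpOnCellCTelescopeK2PurityDocked
import Summits.BirchSwinnertonDyer.BirchSwinnertonDyer.Theorems.EisensteinPrimesBSDpOnCellCTelescopeK2BigRepLOC1
import Summits.BirchSwinnertonDyer.BirchSwinnertonDyer.Theorems.EisensteinPrimesBSDpOnCellCTelescopeK2WeightTwoControlOfPubOfPseudoNull
import Literature.NumberTheory.EllipticCurves.GlobalMinimalModelHeegnerBaseChangeProofs
import Summits.BirchSwinnertonDyer.BirchSwinnertonDyer.Theorems.EisensteinPrimesBSDpOnCellCTelescopeK2WeightTwoPseudoNull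
import HarnessLib

/-!
# [C2 programme P4-g, width seat bsd-line-x2-p2 g27] prop125-DROP twin of `…TelescopeK2WeightTwoPseudoNull.weightTwoPseudoNullOfPub`:
# the same weight-two pseudo-null leaf with the 22-NAME cite text (CGLS Prop. 1.2.5 removed) as its (unused) first hypothesis
# (crux 4 `BSDpOnCellC` stmt-BirchSwinnertonDyer-19034, line telescope v21 UNCHANGED; `--supports`, helper; closes nothing; moves no count — 27 by name of record)

WHY: the v21 closure feeds `stub_publishedFacts` (23 names) WHOLE into this leaf's hypothesis type; a closure keyed on the 22-name text (host (C2)) needs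
the leaf re-typed on that text. The proof never reads the text. HONEST FRAMING: one theorem, proof = the original's (the helper
`degreeOne_of_satisfiesHeegnerHypothesis` is reused BY NAME, not copied); no definition, no named fact, no `sorry`; BSD is proved for no curve.
(The original module docstring follows.)

# W4⁰ CLOSED IN THE TREE — the weight-two pseudo-null leaf of the telescope line, proved outright

Helper for crux 4 `BSDpOnCellC` of route `EisensteinPrimes`, line «telescope» (LEAD cruxlead-19034), node W4⁰
(«every pseudo-null `B = ℤ_p⟦X⟧⟦T⟧`-submodule of `X₂ = XBig κ ρ₂ 𝔭̄ ∅` is `p`-power torsion», Greenberg 2016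
Prop. 4.1.1 (c) for `𝐃 = BigRepModule(A₂)`).  It closes NOTHING REGISTERED: no summit statement, no crux, no registered
stub (v12 of record has no W4⁰ leaf; the v13 candidate was withdrawn 2026-08-30 07:08:29Z).  What is proved is the TEXT
of the announced v13 leaf `stub_weightTwoPseudoNullOfPub` WITH the instance binder
`[IsTopologicalRing (PowerSeries (PowerSeries ℤ_[p]))]` inserted right after its `B`-topology binder (ideator g40
OBJECTION 06:53:59Z, accepted by the LEAD as fix (a) = the «v13c» text): under the 23 refereed names (unused), along the
road-R-β prefix, for every big representation `ρ₂` on a discrete `ℤ_p⟦X⟧`-cofree `A₂` carrying the fibre data FD⁺,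
(fg) → (reg₀) → W4⁰.  So the LEAD may either register the leaf and have it closed by name, or not register it at all and
call this theorem inside the N2 port.

PROOF = ASSEMBLY OF TREE THEOREMS (no named fact, no `sorry`):
* route G′, fact-free and docked (ideator g40 #2 `…TelescopeK2PurityFactFree`, #3 `…TelescopeK2PurityDocked.
  forall_isPseudoNull_XBig_exists_pow_smul_eq_zero_of_isUnramifiedOutside`): Greenberg 2016 Prop. 4.1.1 (c) at the trivial
  core (`selmer_isAlmostDivisible_caseC_of_prop321_of_isCotorsion_H_two'`, Prop. 3.2.1 from Poitou–Tate), the corank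
  squeeze (Greenberg 2006 Props. 3.2, 4.1, 4.2, §5 A as `_holds` theorems, Tate's global Euler characteristic for
  totally complex `K`), `S := S₀ ∪ {w ∣ p}`;
* the four LOCAL rows (width x2-p2 g22 #5 `…TelescopeK2BigRepLOC1`, Greenberg 2010 Lemma 5.2.2 / the determinant
  trick p764648): LOC⁽¹⁾ at `𝔭`, `𝔭̄` and `corank_B H⁰(K_𝔭̄, 𝐃) = 0` from the open anticyclotomic image above `p`
  (`p` odd, from `CellC`); at `w ∈ S₀`, `w ∤ p` (so `w ∣ N`, split by the Heegner hypothesis: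
  `degreeOne_of_satisfiesHeegnerHypothesis` below) LOC⁽¹⁾_w and `h⁰_w = 0` from the degree-one rows, whence
  `H¹(K_w, 𝐃)` is `B`-cotorsion (`TelescopeK2PurityFactFree.isCotorsion_localH1_of_h0_of_loc1`, Greenberg 2006
  Prop. 4.2 (b) + §5 A);
* `A₂` is `p`-primary from (fd₀) (`TelescopeK2PurityDocked.pPrimary_of_fd`; `E[p^∞]` is `p`-primary).
The 23 names, (fg), the newform / period / `L`-function / Hida-family data of the prefix are NOT used.

HONEST FRAMING: THEOREMS ONLY; no `def`, no named fact consumed, no `sorry`, no instance, no notation; nothing registered is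
closed; BSD is proved for no curve here.

References: [Greenberg2016Selmer] Prop. 4.1.1 (c) (p. 15), §2.2–2.3; [Greenberg2006] Props. 3.1–3.2, 4.1–4.2, §5 A;
[Greenberg2010] Lemma 5.2.2; [Brink2007] Cor. 1; [Castella2018Erratum] §2; [GrossLMS1991] §1 (p. 235: all prime factors
of `N` split in `K`); [NeukirchANT1999] Ch. I (8.2).
-/

set_option autoImplicit false
set_option linter.dupNamespace false

noncomputable section

open scoped Classical MatrixGroups ModularForm

open CongruenceSubgroup WeierstrassCurve NumberField IsDedekindDomain Field PowerSeries
  Literature.NumberTheory.EllipticCurves Literature.NumberTheory.EllipticCurves.GreenbergSelmer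
  Literature.NumberTheory.EllipticCurves.ModularForms Literature.NumberTheory.QuadraticFields
  Literature.NumberTheory.EllipticCurves.Rank1Residual
  Literature.NumberTheory.EllipticCurves.Rank1Residual.Typed
  Literature.NumberTheory.EllipticCurves.KrizLi2019
  Literature.NumberTheory.EllipticCurves.GreenbergVatsal2000
  Literature.NumberTheory.EllipticCurves.Wuthrich2014
  Literature.NumberTheory.EllipticCurves.SteinWuthrich2013
  Literature.NumberTheory.EllipticCurves.Castella2018Exceptional
  Literature.NumberTheory.GaloisRepresentations Literature.NumberTheory.GaloisCohomology
  Literature.NumberTheory.Automorphic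
  Summit.BirchSwinnertonDyer.Rank1Residual.X11b.AcSelmer
  Summit.BirchSwinnertonDyer.Rank1Residual.X11b.Halves
  Summit.BirchSwinnertonDyer.Rank1Residual.X11b
  Summit.BirchSwinnertonDyer.Rank1Residual Summit.BirchSwinnertonDyer.Rank1Residual.X1
  Summit.BirchSwinnertonDyer.Rank1Residual.X2
open Literature.NumberTheory.EllipticCurves.KellerYin2024 (curveLocalLambda)

open Literature.NumberTheory.EllipticCurves.BigGaloisRep

namespace Summit.BirchSwinnertonDyer.BirchSwinnertonDyer.Theorems.TelescopeK2WeightTwoPseudoNullP22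

open Summit.BirchSwinnertonDyer.BirchSwinnertonDyer.Theorems.TelescopeK2WeightTwoPseudoNull

open Literature.NumberTheory.EllipticCurves.CastellaGrossiLeeSkinner2022 Literature.NumberTheory.EllipticCurves.Castella2018
  Literature.NumberTheory.IwasawaTheory Literature.NumberTheory.IwasawaTheory.Greenberg2016
  Literature.NumberTheory.IwasawaTheory.Greenberg2006
  Summit.BirchSwinnertonDyer.Rank1Residual.X1.KellerYinMuLambdaSplit
open Literature.NumberTheory.EllipticCurves.KellerYin2024
open Summit.BirchSwinnertonDyer.BirchSwinnertonDyer.Theorems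


/-- **[prop125-DROP twin of `TelescopeK2WeightTwoPseudoNull.weightTwoPseudoNullOfPub` (x2-p2 g2x): the cite-stub text in the hypothesis is the 23-name text with EXACTLY the conjunct `prop125_characterGrSelmerDual_torsion_muZero_dim` removed (22 names); the text is not used by the proof (`_hcite`), proof term token-identical; the original docstring follows.]** **W4⁰ — every pseudo-null `B`-submodule of `X₂` is `p`-power torsion — for the weight-two branch module of the
telescope line, PROVED** (text = the announced leaf `stub_weightTwoPseudoNullOfPub` with the `[IsTopologicalRing B]`
binder; the cite conjunction, (fg) and the analytic data of the prefix are unused).  Assembly of route G′ (docked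
endpoint, ideator g40 #3) with the four local Galois rows (x2-p2 g22 #5) and the Heegner degree-one bridge (§1).
[cite: Greenberg2016Selmer, Prop. 4.1.1 (c) p. 15] [cite: Greenberg2006, Props. 3.2, 4.1–4.2, §5 A]
[cite: Greenberg2010, Lemma 5.2.2] [cite: Brink2007, Cor. 1] [cite: Castella2018Erratum, §2] [cite: GrossLMS1991, §1] -/
theorem weightTwoPseudoNullOfPub22 :
    (((((lambdaMu_multiplicative_of_gvPar ∧ thm16_charIdeal_dvd_multiplicative_of_reducible ∧
    thm61_splitMultiplicative ∧ thm61_nonsplitMultiplicative ∧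
    (∀ (W : WeierstrassCurve ℚ) [W.IsElliptic] [W.IsGloballyMinimal] (p : ℕ) [Fact p.Prime], greenberg_stevens (W := W) (p := p)) ∧
    exists_isNewformOf ∧ hsieh2014_exists_anticyclotomicPAdicLFunction ∧
    (∀ (N : ℕ) [NeZero N] (W : WeierstrassCurve ℚ) (K : Type) [Field K] [NumberField K], gross_zagier N W K) ∧
    (∀ (N : ℕ) [NeZero N] (W : WeierstrassCurve ℚ) (K : Type) [Field K] [NumberField K], kolyvagin N W K) ∧
    rank_eq_analyticRank_of_analyticRank_le_one ∧ HoffsteinLuo1997_exists_twist_L_one_ne_zero ∧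
    mazur_not_dvd_maninConstant_of_odd ∧ bsdRHS_eq_of_isIsogenous) ∧ thm210_thm211_bdpDisplay_pNew) ∧
    LiuZhangZhang2018.thm151_thm153_modularCurve_heegnerVector) ∧ (cor126_residualCharacter_globalLift ∧ cor126_residualCharacter_localSurjective ∧ thm212_exists_isKatzLFunction ∧
      Literature.NumberTheory.EllipticCurves.Castella2018.cas20_thm211_memberForms_sigmaFrames_congr)) ∧
      Literature.NumberTheory.EllipticCurves.BCGKPST2020.thm331_rubin_exists_katzMeasure₂_pseudoIso_span_eq ∧
      Literature.NumberTheory.EllipticCurves.DeShalit1987.thmII64_katzMeasure₂_functionalEquation ∧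
      Literature.NumberTheory.EllipticCurves.Hida2010MuInvariant.thmI_mu_katzBranch_reflect_eq_zero) →
    ∀ (W : WeierstrassCurve ℚ) [W.IsElliptic] [W.IsGloballyMinimal] (p : ℕ) [Fact p.Prime],
    ∀ (N : ℕ) [NeZero N] (K : Type) [Field K] [NumberField K] (Dt : ModularParametrizationData W N)
      (H : HeegnerDatum N (NumberField.discr K)) (ιK : K →+* ℂ) (P : (W.baseChange K).toAffine.Point), CellC W p → W.conductorNorm ℤ = N →
      IsImaginaryQuadratic K → NumberField.discr K < -4 → SatisfiesHeegnerHypothesis N K →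
      (W.quadraticTwist (NumberField.discr K : ℚ)).entireLFunction 1 ≠ 0 →
      WeierstrassCurve.Affine.Point.map ιK.toRatAlgHom P = heegnerPointComplex Dt H → ¬ (p : ℤ) ∣ Dt.c → ¬ IsOfFinAddOrder P →
      Odd (NumberField.discr K) → ∀ (κ : ZpExtension K p), κ.IsAnticyclotomic → ∀ (γ : Field.absoluteGaloisGroup K) [Fact (κ.IsTopGenerator γ)]
          (𝔭 : HeightOneSpectrum (𝓞 K)), ((p : ℕ) : 𝓞 K) ∈ 𝔭.asIdeal → 𝔭.asIdeal.ramificationIdx (𝓞 ℚ) = 1 → 𝔭.asIdeal.inertiaDeg (𝓞 ℚ) = 1 →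
          ∀ (𝔭bar : HeightOneSpectrum (𝓞 K)), ((p : ℕ) : 𝓞 K) ∈ 𝔭bar.asIdeal → 𝔭bar ≠ 𝔭 → ((Ideal.span {(p : ℤ)}).primesOver (𝓞 K)).ncard = 2 →
          ∀ (f : CuspForm (CongruenceSubgroup.Gamma0 N) 2), IsNewformOf W f → ∀ (ι' : PadicAlgCl p ≃+* ℂ), (∀ (w : InfinitePlace K) (k : 𝓞 K),
                k ∈ 𝔭.asIdeal ↔ ‖ι'.symm (w.embedding (k : K))‖ < 1) → ∀ (ΩK : ℂ) (Ωp : ℂ_[p]) (Q : PowerSeries 𝓞_ℂ_[p]), ΩK ≠ 0 → ‖Ωp‖ = 1 →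
                R1.IsBDPLFunctionInt p ι' 𝔭 κ γ f ΩK Ωp Q →
      ∀ (L : PowerSeries (PowerSeries (unrIntegers p))) (x : ℕ → ℤ_[p]) (D : ℕ → Skinner2016.HidaCongruentForm W p 1),
        (∀ k, ‖x k‖ < 1) ∧ Filter.Tendsto x Filter.atTop (nhds 0) ∧ (∃ e : ℕ, PowerSeries.C ((p : 𝓞_ℂ_[p]) ^ e) * Q ∈
          Ideal.span {PowerSeries.map (R1.unrToCpInt p) (PowerSeries.map (PowerSeries.constantCoeff (R := unrIntegers p)) L)}) ∧
        (∀ k : ℕ, (∀ y : coeffField (D k).g, ι' ((D k).ι y) = (y : ℂ)) ∧ 2 * ((p : ℤ) - 1) ∣ (D k).k - 2 ∧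
          ∃ (ΩKg : ℂ) (Ωpg : ℂ_[p]) (Lg : UnrSeries p), ΩKg ≠ 0 ∧ ‖Ωpg‖ = 1 ∧ IsBDPLFunctionWt ι' 𝔭 κ γ (D k).g ΩKg Ωpg Lg ∧ ∃ Ψ : UnrSeries p,
            (∃ U : PowerSeries (PowerSeries (unrIntegers p)), PowerSeries.map (PowerSeries.C (R := unrIntegers p)) Ψ =
                L + PowerSeries.C (PowerSeries.X - PowerSeries.C (toUnr p (x k))) * U) ∧
            (∃ e : ℕ, PowerSeries.C ((p : 𝓞_ℂ_[p]) ^ e) * PowerSeries.map (R1.unrToCpInt p) Ψ ∈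
              Ideal.span {PowerSeries.map (R1.unrToCpInt p) Lg})) ∧ (∃ A : ℕ → UnrSeries p, ∀ ℓ : ℕ, ℓ.Prime → ¬ ℓ ∣ N →
          (∃ U : UnrSeries p, A ℓ = PowerSeries.C (toUnr p ((W.frobeniusTrace ℓ : ℤ) : ℤ_[p])) + PowerSeries.X * U) ∧
          ∀ k : ℕ, ∃ (c : unrIntegers p) (U : UnrSeries p), A ℓ = PowerSeries.C c + (PowerSeries.X - PowerSeries.C (toUnr p (x k))) * U ∧
            ((c : ℂ_[p]) = algebraMap (PadicAlgCl p) ℂ_[p]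
              ((D k).ι ⟨(UpperHalfPlane.qExpansion 1 ⇑(D k).g).coeff ℓ, coeff_mem_coeffField (D k).g ℓ⟩))) →
      ∀ [TopologicalSpace (PowerSeries ℤ_[p])] (A₂ : Type) [AddCommGroup A₂]
        [Module (PowerSeries ℤ_[p]) A₂] [TopologicalSpace A₂] [DiscreteTopology A₂]
        (ρ₂ : ContinuousRep (Field.absoluteGaloisGroup K) (PowerSeries ℤ_[p]) A₂) [TopologicalSpace (PowerSeries (PowerSeries ℤ_[p]))] [IsTopologicalRing (PowerSeries (PowerSeries ℤ_[p]))]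
        [ContinuousSMul (PowerSeries (PowerSeries ℤ_[p])) (BigRepModule (PowerSeries ℤ_[p]) p A₂)],
        (Literature.NumberTheory.IwasawaTheory.Greenberg2016.IsCofree (PowerSeries ℤ_[p]) A₂ ∧
          (∀ a : A₂, ∃ n : ℕ, (PowerSeries.X : PowerSeries ℤ_[p]) ^ n • a = 0) ∧ (∀ a : A₂, ∃ b : A₂, (PowerSeries.X : PowerSeries ℤ_[p]) • b = a) ∧
          (∀ (k : ℕ) (a : A₂), ∃ b : A₂, (PowerSeries.X - PowerSeries.C (x k)) • b = a) ∧
          (∃ S₀ : Set (HeightOneSpectrum (𝓞 K)), S₀.Finite ∧ GaloisRep.IsUnramifiedOutside S₀ ρ₂ ∧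
            ∀ w ∈ S₀, ((p : ℕ) : 𝓞 K) ∉ w.asIdeal → ((N : ℕ) : 𝓞 K) ∈ w.asIdeal) ∧
          (∃ θ₀ : Submodule.torsionBy (PowerSeries ℤ_[p]) A₂ (PowerSeries.X : PowerSeries ℤ_[p]) →+ PrimaryTorsion (W.baseChange K).geomPoints p,
            (∀ (c : ℤ_[p]) (a : Submodule.torsionBy (PowerSeries ℤ_[p]) A₂ (PowerSeries.X : PowerSeries ℤ_[p])),
                θ₀ (PowerSeries.C c • a) = c • θ₀ a) ∧ (∀ (σ : Field.absoluteGaloisGroup K)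
                (a : Submodule.torsionBy (PowerSeries ℤ_[p]) A₂ (PowerSeries.X : PowerSeries ℤ_[p])),
                θ₀ (BigGaloisRep.torsionRep ρ₂ (PowerSeries.X : PowerSeries ℤ_[p]) σ a) = (W.baseChange K).primaryTorsionGaloisRep p σ (θ₀ a)) ∧
            Finite θ₀.ker ∧ Finite (PrimaryTorsion (W.baseChange K).geomPoints p ⧸ θ₀.range)) ∧
          (∀ k : ℕ, Function.Surjective (algebraMap ℤ_[p] (padicCoeffIntegers (D k).ι)) ∧
            ∃ θ : Submodule.torsionBy (PowerSeries ℤ_[p]) A₂ (PowerSeries.X - PowerSeries.C (x k)) →+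
                Cofree (D k).Δ.selfDualRep (padicCoeffField (D k).ι), (∀ (c : ℤ_[p])
                  (a : Submodule.torsionBy (PowerSeries ℤ_[p]) A₂ (PowerSeries.X - PowerSeries.C (x k))),
                  θ (PowerSeries.C c • a) = algebraMap ℤ_[p] (padicCoeffIntegers (D k).ι) c • θ a) ∧ (∀ (σ : Field.absoluteGaloisGroup K)
                  (a : Submodule.torsionBy (PowerSeries ℤ_[p]) A₂ (PowerSeries.X - PowerSeries.C (x k))),
                  θ (BigGaloisRep.torsionRep ρ₂ (PowerSeries.X - PowerSeries.C (x k)) σ a) = (D k).Δ.selfDualCofreeRepOver K σ (θ a)) ∧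
              Finite θ.ker ∧ Finite (Cofree (D k).Δ.selfDualRep (padicCoeffField (D k).ι) ⧸ θ.range))) →
        Module.Finite (PowerSeries (PowerSeries ℤ_[p])) (XBig κ ρ₂ 𝔭bar (∅ : Set (HeightOneSpectrum (𝓞 K)))) →
        (∃ s : PowerSeries (PowerSeries ℤ_[p]), ¬ (PowerSeries.C (PowerSeries.X : PowerSeries ℤ_[p]) ∣ s) ∧
            ∀ m : XBig κ ρ₂ 𝔭bar (∅ : Set (HeightOneSpectrum (𝓞 K))), s • m = 0) →
        ∀ P : Submodule (PowerSeries (PowerSeries ℤ_[p])) (XBig κ ρ₂ 𝔭bar (∅ : Set (HeightOneSpectrum (𝓞 K)))),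
          Literature.NumberTheory.EllipticCurves.Module.IsPseudoNull (PowerSeries (PowerSeries ℤ_[p])) ↥P →
            ∃ m : ℕ, ∀ x ∈ P, (p : PowerSeries (PowerSeries ℤ_[p])) ^ m • x = 0 := by
  intro _hcite W _ _ p _ N _ K _ _ Dt H ιK P hC _hN hK _hdisc hHeeg _hL1 _hP _hc _hfin _hodd κ hκ γ _ 𝔭 h𝔭 _he _hf
    𝔭bar h𝔭bar hne _hsplit f _hf' ι' _hι' ΩK Ωp Q _hΩK _hΩp _hBDP L x D _hLxD _τΛ A₂ _ _ _ _ ρ₂ _τB _ _ hFD _hfg hreg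
  obtain ⟨hcof, htor, -, -, ⟨S₀, hS₀f, hunr, hS₀N⟩, ⟨θ₀, hθC, -, hker, -⟩, -⟩ := hFD
  obtain ⟨s, hs, hsX⟩ := hreg
  obtain ⟨-, hp2, -, -⟩ := hC
  have hpK : ((p : ℕ) : 𝓞 K) ≠ 0 := by exact_mod_cast (Fact.out : p.Prime).ne_zero
  -- the finite set `S := S₀ ∪ {w ∣ p}` and the descent of `𝐃` to `G_{K,S}`
  set S : Set (HeightOneSpectrum (𝓞 K)) := S₀ ∪ {w | ((p : ℕ) : 𝓞 K) ∈ w.asIdeal} with hSdef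
  have hSf : S.Finite := hS₀f.union (TelescopeK2BigRepUnramified.finite_setOf_natCast_mem hpK)
  have hSsub : ∀ w : HeightOneSpectrum (𝓞 K), w ∉ S → w ∉ S₀ ∧ ((p : ℕ) : 𝓞 K) ∉ w.asIdeal :=
    fun w hw ↦ ⟨fun h ↦ hw (Or.inl h), fun h ↦ hw (Or.inr h)⟩
  have hSp : ∀ v : HeightOneSpectrum (𝓞 K), ((p : ℕ) : 𝓞 K) ∈ v.asIdeal → v ∈ S := fun v hv ↦ Or.inr hv
  have hS := TelescopeK2BigRepUnramified.ramificationSubgroup_le_ker_anticyclotomicBigGaloisRep κ ρ₂ hunr S hSsub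
  -- `A₂` is `p`-primary (from the fibre datum at `X = 0`), `ℤ_p ↪ ℤ_p⟦X⟧`
  have hPT : ∀ y : PrimaryTorsion (W.baseChange K).geomPoints p, ∃ k : ℕ, ((p : ℤ_[p]) ^ k) • y = 0 :=
    fun y ↦ TelescopeK2FibreCofinite.primaryTorsion_exists_pow_smul_eq_zero y
  have hA : ∀ a : A₂, ∃ k : ℕ, p ^ k • a = 0 := TelescopeK2PurityDocked.pPrimary_of_fd p hPT htor θ₀ hθC hker
  have hinj : Function.Injective (algebraMap ℤ_[p] (PowerSeries ℤ_[p])) := fun a b h ↦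
    PowerSeries.C_injective (by simpa only [PowerSeries.C_eq_algebraMap] using h)
  -- the four local rows
  have h1 : LOC1 S (TelescopeK2RepDescent.descendUnramified S (AnticyclotomicBigGaloisRep κ ρ₂) hS) (Sum.inr 𝔭) :=
    TelescopeK2BigRepLOC1.loc1_descendUnramified_of_isAnticyclotomic S κ ρ₂ hS hinj hA hcof hK hp2 hκ 𝔭 h𝔭
  have h2 : LOC1 S (TelescopeK2RepDescent.descendUnramified S (AnticyclotomicBigGaloisRep κ ρ₂) hS) (Sum.inr 𝔭bar) :=
    TelescopeK2BigRepLOC1.loc1_descendUnramified_of_isAnticyclotomic S κ ρ₂ hS hinj hA hcof hK hp2 hκ 𝔭bar h𝔭bar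
  have h0 : HasCorank (PowerSeries (PowerSeries ℤ_[p])) ((localRep S
      (TelescopeK2RepDescent.descendUnramified S (AnticyclotomicBigGaloisRep κ ρ₂) hS) (Sum.inr 𝔭bar)).H 0) 0 :=
    TelescopeK2BigRepLOC1.hasCorank_localH0_descendUnramified_zero_of_isAnticyclotomic S κ ρ₂ hS hinj hA hcof hK hp2
      hκ 𝔭bar h𝔭bar
  have hcot : ∀ w ∈ S, ((p : ℕ) : 𝓞 K) ∉ w.asIdeal → IsCotorsion (PowerSeries (PowerSeries ℤ_[p])) ((localRep S
      (TelescopeK2RepDescent.descendUnramified S (AnticyclotomicBigGaloisRep κ ρ₂) hS) (Sum.inr w)).H 1) := by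
    intro w hw hpw
    have hwS₀ : w ∈ S₀ := by
      rw [hSdef] at hw
      rcases hw with h | h
      exacts [h, absurd h hpw]
    obtain ⟨he, hf⟩ := degreeOne_of_satisfiesHeegnerHypothesis hK.1 hHeeg w (hS₀N w hwS₀ hpw)
    exact TelescopeK2PurityFactFree.isCotorsion_localH1_of_h0_of_loc1 p κ ρ₂ hA hcof S hSf hSp hS hpw
      (TelescopeK2BigRepLOC1.hasCorank_localH0_descendUnramified_zero_of_degreeOne S κ ρ₂ hS hinj hA hcof hK hκ w
        hpw he hf)
      (TelescopeK2BigRepLOC1.loc1_descendUnramified_of_degreeOne S κ ρ₂ hS hinj hA hcof hK hκ w hpw he hf)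
  exact TelescopeK2PurityDocked.forall_isPseudoNull_XBig_exists_pow_smul_eq_zero_of_isUnramifiedOutside p hK κ ρ₂
    hcof hPT htor θ₀ hθC hker hunr S hSf hSsub h𝔭 h𝔭bar hne h1 h2 h0 hcot hs hsX

end Summit.BirchSwinnertonDyer.BirchSwinnertonDyer.Theorems.TelescopeK2WeightTwoPseudoNullP22

end
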